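import Mathlib

/-!
# The number of cusp preimages of a Belyi map on `ℙ¹` that is noncritical at `∞`

Riemann–Hurwitz for a Belyi map `β : ℙ¹ → ℙ¹` of degree `n` gives `#β⁻¹{0, 1, ∞} = n + 2`
(`−2 = −2n + Σ (e_P − 1)` and all ramification lies over the three cusps).  Scherr–Zieve,
*Separated Belyi maps* [cite: ScherrZieve2014], use exactly this count (proof of Prop. 9:
"`2g − 2 = −2d + Σ_{P ∈ B}(e(P) − 1) = −2d + 3d − #B`, so that `d = 2g − 2 + #B`", here `g = 0`).

We prove it in the tree's `(p, q) ∈ ℚ[x]²` format, for a pair as produced by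
`NoncriticalBelyi.exists_belyi_noncritical_infty` (`NoncriticalBelyiGenusZero.lean`): `p, q`
coprime, `deg p = deg q = deg (p − q) = n ≥ 1` (so `∞ ∉ β⁻¹{0,1,∞}`), `p_{n−1} q_n ≠ p_n q_{n−1}`
(`β` unramified at `∞`), and the Belyi clause at finite non-poles.  Then the number of distinct
complex roots of `p·q·(p − q)` — i.e. `#β⁻¹{0, 1, ∞}` — is exactly `n + 2`
(`NoncriticalBelyi.card_cusp_preimages`).  The proof is the polynomial Riemann–Hurwitz count
through the Wronskian `W = p'q − pq'`: `deg W = 2n − 2` (from `q_n·W = U'q − Uq'` with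
`U = q_n p − p_n q` of degree exactly `n − 1`), every root of `W` is a root of `p q (p − q)` (Belyi
clause), and at a root `r` of `p q (p − q)` of multiplicity `m`, `ord_r W = m − 1`; hence
`Σ_r (m_r − 1) = 2n − 2` while `Σ_r m_r = 3n`.  No definitions, no named facts.
-/

namespace Literature.NumberTheory.DiophantineGeometry

open Polynomial Finset

namespace NoncriticalBelyi

/-- `ord_r (−P) = ord_r P`. [folklore] -/
private theorem rootMultiplicity_neg' {K : Type*} [CommRing K] [IsDomain K] (P : K[X]) (r : K) :
    rootMultiplicity r (-P) = rootMultiplicity r P := by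
  by_cases h : P = 0
  · simp [h]
  have h' : -P ≠ 0 := neg_ne_zero.2 h
  apply le_antisymm
  · rw [le_rootMultiplicity_iff h]; exact dvd_neg.1 (pow_rootMultiplicity_dvd (-P) r)
  · rw [le_rootMultiplicity_iff h']; exact dvd_neg.2 (pow_rootMultiplicity_dvd P r)

/-- Order of the Wronskian at a root of one side: if `r` is a root of `f` but not of `g` (over a
field of characteristic `0`), then `ord_r (f'g − fg') = ord_r f − 1`. [folklore] -/
private theorem rootMultiplicity_wronskian {K : Type*} [Field K] [CharZero K] {f g : K[X]} {r : K}
    (hf : f.IsRoot r) (hg : ¬ g.IsRoot r) (hW : derivative f * g - f * derivative g ≠ 0) :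
    rootMultiplicity r (derivative f * g - f * derivative g) = rootMultiplicity r f - 1 := by
  have hf0 : f ≠ 0 := by rintro rfl; simp at hW
  set m := rootMultiplicity r f with hm
  have hm1 : 1 ≤ m := (rootMultiplicity_pos hf0).2 hf
  have hder : rootMultiplicity r (derivative f) = m - 1 := derivative_rootMultiplicity_of_root hf
  refine le_antisymm ?_ ?_
  · -- `¬ (X - r)^m ∣ W`
    rw [rootMultiplicity_le_iff hW, Nat.sub_add_cancel hm1]
    intro hdvd
    have h1 : (X - C r) ^ m ∣ f * derivative g := (pow_rootMultiplicity_dvd f r).mul_right _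
    have h2 : (X - C r) ^ m ∣ derivative f * g := by
      have := dvd_add hdvd h1; rwa [sub_add_cancel] at this
    have hng : ¬ (X - C r) ∣ g := by rwa [dvd_iff_isRoot]
    have h3 : (X - C r) ^ m ∣ derivative f := (prime_X_sub_C r).pow_dvd_of_dvd_mul_right m hng h2
    have hder0 : derivative f ≠ 0 := by
      intro h0
      have := Polynomial.derivative_eq_zero.1 h0
      -- `f` constant and `f(r) = 0` force `f = 0`
      rw [eq_C_of_natDegree_eq_zero this, IsRoot.def, eval_C] at hf
      apply hf0; rw [eq_C_of_natDegree_eq_zero this, hf, map_zero]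
    have := (le_rootMultiplicity_iff hder0).2 h3
    omega
  · -- `(X - r)^(m-1) ∣ W`
    rw [le_rootMultiplicity_iff hW]
    refine dvd_sub ?_ ?_
    · rcases eq_or_ne (derivative f) 0 with h0 | h0
      · rw [h0, zero_mul]; exact dvd_zero _
      · exact (((le_rootMultiplicity_iff h0).1 hder.ge)).mul_right _
    · exact ((pow_dvd_pow _ (Nat.sub_le m 1)).trans (pow_rootMultiplicity_dvd f r)).mul_right _

/-- Degree of the Wronskian of two polynomials of the same degree `n ≥ 1` whose ratio is unramified
at `∞` (`p_{n−1} q_n ≠ p_n q_{n−1}`): `p'q − pq' ≠ 0` and `deg (p'q − pq') = 2n − 2`. [folklore] -/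
private theorem natDegree_wronskian {K : Type*} [Field K] [CharZero K] {p q : K[X]} {n : ℕ}
    (hn : 0 < n) (hp : p.natDegree = n) (hq : q.natDegree = n)
    (hunr : p.coeff (n - 1) * q.coeff n ≠ p.coeff n * q.coeff (n - 1)) :
    derivative p * q - p * derivative q ≠ 0 ∧
      (derivative p * q - p * derivative q).natDegree = 2 * n - 2 := by
  have hq0 : q ≠ 0 := by rintro rfl; simp at hunr
  have hqn : q.coeff n ≠ 0 := by rw [← hq, coeff_natDegree]; exact leadingCoeff_ne_zero.2 hq0
  set W := derivative p * q - p * derivative q with hWdef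
  -- `U := q_n p − p_n q`, `q_n · W = U'q − Uq'`
  set U : K[X] := C (q.coeff n) * p - C (p.coeff n) * q with hU
  have hUcoeff : ∀ i, U.coeff i = q.coeff n * p.coeff i - p.coeff n * q.coeff i := by
    intro i; rw [hU, coeff_sub, coeff_C_mul, coeff_C_mul]
  have hWU : C (q.coeff n) * W = derivative U * q - U * derivative q := by
    rw [hWdef, hU]; simp only [derivative_sub, derivative_mul, derivative_C, zero_mul, zero_add]
    ring
  -- it suffices to control `C q_n * W`
  suffices h : C (q.coeff n) * W ≠ 0 ∧ (C (q.coeff n) * W).natDegree = 2 * n - 2 by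
    refine ⟨fun h0 => h.1 (by rw [h0, mul_zero]), ?_⟩
    rw [← h.2, natDegree_C_mul hqn]
  rw [hWU]
  obtain ⟨k, rfl⟩ : ∃ k, n = k + 1 := ⟨n - 1, by omega⟩
  simp only [Nat.add_sub_cancel] at hunr hUcoeff ⊢
  have hUdeg : U.natDegree ≤ k := by
    rw [natDegree_le_iff_coeff_eq_zero]
    intro i hi
    rw [hUcoeff]
    rcases Nat.lt_or_ge (k + 1) i with h | h
    · rw [coeff_eq_zero_of_natDegree_lt (show p.natDegree < i by omega),
        coeff_eq_zero_of_natDegree_lt (show q.natDegree < i by omega)]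
      ring
    · have : i = k + 1 := by omega
      subst this; ring
  have hUtop : U.coeff k ≠ 0 := by
    rw [hUcoeff]; intro h; apply hunr; linear_combination h
  have hq'deg : (derivative q).natDegree ≤ k := by
    have := natDegree_derivative_le q; rw [hq] at this; simpa using this
  have hq'top : (derivative q).coeff k = (k + 1 : K) * q.coeff (k + 1) := by
    rw [coeff_derivative]; ring
  have h2 : (U * derivative q).coeff (k + k) = U.coeff k * ((k + 1 : K) * q.coeff (k + 1)) := by
    rw [coeff_mul_add_eq_of_natDegree_le hUdeg hq'deg, hq'top]
  rcases Nat.eq_zero_or_pos k with hk | hk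
  · -- `n = 1`: `U` is a nonzero constant, `U' = 0`
    subst hk
    have hU' : derivative U = 0 := by
      rw [eq_C_of_natDegree_eq_zero (Nat.le_zero.1 hUdeg), derivative_C]
    rw [hU', zero_mul, zero_sub]
    have hval : U * derivative q = C (U.coeff 0 * q.coeff 1) := by
      rw [eq_C_of_natDegree_eq_zero (Nat.le_zero.1 hUdeg), eq_C_of_natDegree_eq_zero
        (Nat.le_zero.1 hq'deg), ← C_mul, coeff_C_zero, hq'top]
      simp
    have hc : U.coeff 0 * q.coeff 1 ≠ 0 := mul_ne_zero hUtop hqn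
    refine ⟨by rw [hval, neg_ne_zero, ne_eq, C_eq_zero]; exact hc, ?_⟩
    rw [hval, ← map_neg, natDegree_C]
  · -- `n ≥ 2`
    have hU'deg : (derivative U).natDegree ≤ k - 1 :=
      (natDegree_derivative_le U).trans (Nat.sub_le_sub_right hUdeg 1)
    have hle : (derivative U * q - U * derivative q).natDegree ≤ 2 * (k + 1) - 2 := by
      have h2k : 2 * (k + 1) - 2 = 2 * k := by omega
      rw [h2k]
      refine (natDegree_sub_le _ _).trans (max_le ?_ ?_)
      · refine natDegree_mul_le.trans ?_
        rw [hq]; omega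
      · exact natDegree_mul_le.trans (by omega)
    have htop : (derivative U * q - U * derivative q).coeff (2 * (k + 1) - 2) ≠ 0 := by
      have h2k : 2 * (k + 1) - 2 = k + k := by omega
      have hkk : k + k = (k - 1) + (k + 1) := by omega
      have h1 : (derivative U * q).coeff (k + k) =
          (derivative U).coeff (k - 1) * q.coeff (k + 1) := by
        rw [hkk]; exact coeff_mul_add_eq_of_natDegree_le hU'deg hq.le
      rw [h2k, coeff_sub, h1, h2, coeff_derivative, show k - 1 + 1 = k by omega]
      have : U.coeff k * ((k - 1 : ℕ) + 1 : K) * q.coeff (k + 1) -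
          U.coeff k * ((k + 1 : K) * q.coeff (k + 1)) = -(U.coeff k * q.coeff (k + 1)) := by
        rw [Nat.cast_sub hk]; push_cast; ring
      rw [this, neg_ne_zero]
      exact mul_ne_zero hUtop hqn
    have hne : derivative U * q - U * derivative q ≠ 0 := fun h => htop (by rw [h, coeff_zero])
    exact ⟨hne, natDegree_eq_of_le_of_coeff_ne_zero hle htop⟩

/-- **`#β⁻¹{0, 1, ∞} = deg β + 2`** for a Belyi pair `(p, q)` over `ℚ` that is noncritical at `∞`
(Riemann–Hurwitz on `ℙ¹`, as in Scherr–Zieve's count `d = 2g − 2 + #B` with `g = 0`): if `p, q` are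
coprime with `deg p = deg q = deg (p − q) = n ≥ 1`, `p_{n−1} q_n ≠ p_n q_{n−1}`, and every non-polar
complex zero of `p'q − pq'` has `β`-value `0` or `1`, then `p·q·(p − q)` has exactly `n + 2`
distinct complex roots. [cite: ScherrZieve2014, Prop 9 (proof)] -/
theorem card_cusp_preimages (p q : ℚ[X]) (n : ℕ) (hn : 0 < n) (hp : p.natDegree = n)
    (hq : q.natDegree = n) (hpq : (p - q).natDegree = n)
    (hunr : p.coeff (n - 1) * q.coeff n ≠ p.coeff n * q.coeff (n - 1)) (hcop : IsCoprime p q)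
    (hbel : ∀ z : ℂ, aeval z q ≠ 0 → aeval z (derivative p * q - p * derivative q) = 0 →
      aeval z p = 0 ∨ aeval z p = aeval z q) :
    ((p * q * (p - q)).map (algebraMap ℚ ℂ)).roots.toFinset.card = n + 2 := by
  classical
  set f : ℂ[X] := p.map (algebraMap ℚ ℂ) with hf
  set g : ℂ[X] := q.map (algebraMap ℚ ℂ) with hg
  have hinj := (algebraMap ℚ ℂ).injective
  have hfn : f.natDegree = n := by rw [hf, natDegree_map_eq_of_injective hinj, hp]
  have hgn : g.natDegree = n := by rw [hg, natDegree_map_eq_of_injective hinj, hq]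
  have hfgn : (f - g).natDegree = n := by
    rw [hf, hg, ← Polynomial.map_sub, natDegree_map_eq_of_injective hinj, hpq]
  have hF : (p * q * (p - q)).map (algebraMap ℚ ℂ) = f * g * (f - g) := by
    rw [Polynomial.map_mul, Polynomial.map_mul, Polynomial.map_sub]
  have hf0 : f ≠ 0 := by rintro h; rw [h, natDegree_zero] at hfn; omega
  have hg0 : g ≠ 0 := by rintro h; rw [h, natDegree_zero] at hgn; omega
  have hfg0 : f - g ≠ 0 := by rintro h; rw [h, natDegree_zero] at hfgn; omega
  have hF0 : f * g * (f - g) ≠ 0 := mul_ne_zero (mul_ne_zero hf0 hg0) hfg0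
  have hFdeg : (f * g * (f - g)).natDegree = 3 * n := by
    rw [natDegree_mul (mul_ne_zero hf0 hg0) hfg0, natDegree_mul hf0 hg0, hfn, hgn, hfgn]; ring
  -- the Wronskian over `ℂ`
  set W : ℂ[X] := derivative f * g - f * derivative g with hWdef
  have hcoeff : ∀ i,
      f.coeff i = algebraMap ℚ ℂ (p.coeff i) ∧ g.coeff i = algebraMap ℚ ℂ (q.coeff i) :=
    fun i => ⟨by rw [hf, coeff_map], by rw [hg, coeff_map]⟩
  have hunr' : f.coeff (n - 1) * g.coeff n ≠ f.coeff n * g.coeff (n - 1) := by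
    rw [(hcoeff _).1, (hcoeff _).2, (hcoeff _).1, (hcoeff _).2, ← map_mul, ← map_mul]
    exact fun h => hunr (hinj h)
  obtain ⟨hW0, hWdeg⟩ := natDegree_wronskian hn hfn hgn hunr'
  have hW0W : W ≠ 0 := by rw [hWdef]; exact hW0
  have hWaeval : ∀ z : ℂ, W.eval z = aeval z (derivative p * q - p * derivative q) := by
    intro z
    rw [hWdef, hf, hg, derivative_map, derivative_map, ← Polynomial.map_mul,
      ← Polynomial.map_mul, ← Polynomial.map_sub, eval_map_algebraMap]
  -- coprimality over `ℂ`: no common root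
  have hnoroot : ∀ r : ℂ, f.IsRoot r → ¬ g.IsRoot r := by
    intro r hfr hgr
    obtain ⟨a, b, hab⟩ := hcop
    have := congrArg (aeval r) hab
    rw [map_add, map_mul, map_mul, map_one] at this
    rw [IsRoot.def, hf, eval_map_algebraMap] at hfr
    rw [IsRoot.def, hg, eval_map_algebraMap] at hgr
    rw [hfr, hgr, mul_zero, mul_zero, add_zero] at this
    exact zero_ne_one this
  -- every root of `W` is a root of `F`
  have hWF : ∀ z : ℂ, W.IsRoot z → (f * g * (f - g)).IsRoot z := by
    intro z hz
    rw [IsRoot.def, hWaeval] at hz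
    rw [IsRoot.def, eval_mul, eval_mul, eval_sub]
    by_cases hgz : g.eval z = 0
    · rw [hgz, mul_zero, zero_mul]
    · have hgz' : aeval z q ≠ 0 := by rwa [hg, eval_map_algebraMap] at hgz
      rcases hbel z hgz' hz with h | h
      · rw [show f.eval z = 0 by rw [hf, eval_map_algebraMap, h], zero_mul, zero_mul]
      · have : f.eval z = g.eval z := by rw [hf, hg, eval_map_algebraMap, eval_map_algebraMap, h]
        rw [this, sub_self, mul_zero]
  -- at each root `r` of `F`: `ord_r W = ord_r F − 1`
  have hmult : ∀ r : ℂ, (f * g * (f - g)).IsRoot r →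
      rootMultiplicity r W = rootMultiplicity r (f * g * (f - g)) - 1 := by
    intro r hr
    rw [rootMultiplicity_mul hF0, rootMultiplicity_mul (mul_ne_zero hf0 hg0)]
    rw [IsRoot.def, eval_mul, eval_mul, eval_sub, mul_eq_zero, mul_eq_zero] at hr
    by_cases hfr : f.IsRoot r
    · -- root of `f`
      have hgr : ¬ g.IsRoot r := hnoroot r hfr
      have hfgr : ¬ (f - g).IsRoot r := by
        rw [IsRoot.def, eval_sub, hfr.eq_zero, zero_sub, neg_eq_zero]; exact hgr
      rw [rootMultiplicity_eq_zero hgr, rootMultiplicity_eq_zero hfgr, add_zero, add_zero]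
      exact rootMultiplicity_wronskian hfr hgr hW0
    by_cases hgr : g.IsRoot r
    · -- root of `g`
      have hfgr : ¬ (f - g).IsRoot r := by
        rw [IsRoot.def, eval_sub, hgr.eq_zero, sub_zero]; exact hfr
      rw [rootMultiplicity_eq_zero hfr, rootMultiplicity_eq_zero hfgr, zero_add, add_zero]
      have hW' : W = -(derivative g * f - g * derivative f) := by rw [hWdef]; ring
      have hW0' : derivative g * f - g * derivative f ≠ 0 := by
        intro h; apply hW0W; rw [hW', h, neg_zero]
      rw [hW', rootMultiplicity_neg']
      exact rootMultiplicity_wronskian hgr hfr hW0'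
    · -- root of `f - g`
      have hfgr : (f - g).IsRoot r := by
        rcases hr with (h | h) | h
        · exact absurd h hfr
        · exact absurd h hgr
        · rw [IsRoot.def, eval_sub]; exact h
      rw [rootMultiplicity_eq_zero hfr, rootMultiplicity_eq_zero hgr, zero_add, zero_add]
      have hW' : W = derivative (f - g) * g - (f - g) * derivative g := by
        rw [hWdef, derivative_sub]; ring
      have hW0'' : derivative (f - g) * g - (f - g) * derivative g ≠ 0 := by
        rw [← hW']; exact hW0W
      rw [hW']
      exact rootMultiplicity_wronskian hfgr hgr hW0''
  -- counting
  set RF := (f * g * (f - g)).roots with hRF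
  set RW := W.roots with hRW
  have hcardF : Multiset.card RF = 3 * n := by
    rw [hRF, IsAlgClosed.card_roots_eq_natDegree, hFdeg]
  have hcardW : Multiset.card RW = 2 * n - 2 := by
    rw [hRW, IsAlgClosed.card_roots_eq_natDegree, hWdeg]
  have hsub : ∀ a ∈ RW, a ∈ RF.toFinset := by
    intro a ha
    rw [Multiset.mem_toFinset, hRF, mem_roots hF0]
    exact hWF a ((mem_roots hW0).1 ha)
  have hsumW : ∑ r ∈ RF.toFinset, RW.count r = 2 * n - 2 := by
    rw [Multiset.sum_count_eq_card hsub, hcardW]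
  have hsumF : ∑ r ∈ RF.toFinset, RF.count r = 3 * n := by
    rw [Multiset.toFinset_sum_count_eq, hcardF]
  have hrel : ∀ r ∈ RF.toFinset, RW.count r = RF.count r - 1 ∧ 1 ≤ RF.count r := by
    intro r hr
    rw [Multiset.mem_toFinset] at hr
    refine ⟨?_, Multiset.one_le_count_iff_mem.2 hr⟩
    rw [hRW, hRF, count_roots, count_roots]
    exact hmult r ((mem_roots hF0).1 hr)
  have hsum1 : ∑ r ∈ RF.toFinset, RF.count r =
      (∑ r ∈ RF.toFinset, RW.count r) + RF.toFinset.card := by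
    rw [card_eq_sum_ones, ← sum_add_distrib]
    refine sum_congr rfl fun r hr => ?_
    obtain ⟨h1, h2⟩ := hrel r hr
    rw [h1]; omega
  rw [hF]
  change RF.toFinset.card = n + 2
  omega

end NoncriticalBelyi

end Literature.NumberTheory.DiophantineGeometry
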